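import Summits.HubbardSuperconductivity.HubbardLadder.PairModeBlocks
import Literature.MathematicalPhysics.QuantumLattice.ApproximateEigenvectorLemmas
import HarnessLib

/-!
# Binned norm bounds for weighted pair operators and the `d`-wave pair field

pub-hubbard r3 — rung 0′ of the R4 ceiling ladder (R4-MEMO §9.10). HONEST FRAMING: ladder R1–R4
with certified numbers; no claim on H/H₀. NEW cell-side mathematics (not a published result), staged
by the r3 planner seat for a prover/librarian seat. Part 2 of 4 (imports `PairModeBlocks`).

* norm form of the block bound: `‖b_P ψ‖ ≤ (|P|/2 + 1)‖ψ‖` (`eucNorm_blockPair_mulVec_le`);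
* `eucNorm_weightedBlock_mulVec_le`: `‖Σ_{k∈P} φ_k b_k ψ‖ ≤ (|v|(|P|/2+1) + ε|P|)‖ψ‖` when
  `|φ_k - v| ≤ ε` on `P`;
* **binned bounds** for `B(φ,S) = Σ_{k∈S} φ_k b_k = pairOperator φ S`
  (`eucNorm_pairOperator_mulVec_le_of_bins`, `…_floorBins`): for every bin width `ε > 0`,
  `‖B(φ,S)ψ‖ ≤ (½Σ_{k∈S}|φ_k| + (3/2)ε|S| + (2Φmax/ε + 1)(Φmax + ε))‖ψ‖` (`|φ| ≤ Φmax` on `S`);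
* **the `d`-wave pair field** (`Δ_d†Δ_d = 8 B(ĝ_d)†B(ĝ_d)`, tree lemma
  `conjTranspose_pairField_dWave_mul_self`): `re_expect_pairField_dWave_sq_le`:
  `Re⟨ψ,Δ_d†Δ_dψ⟩ ≤ 8(Φ_L/2 + (3/2)εL² + (4/ε+1)(2+ε))²‖ψ‖²`, `Φ_L = Σ_k |cos k₁ - cos k₂|`.
-/

namespace Summit.HubbardSuperconductivity.HubbardLadder

open Matrix Finset Literature.Probability.LatticeModels Literature.MathematicalPhysics.QuantumLattice
open scoped ComplexOrder ComplexConjugate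

variable {L : ℕ} [NeZero L]

/-! ### Norm form, weighted (binned) blocks, and the `d`-wave pair field -/

section weighted
variable (ψ : Fock (Orb (FermionTorus 2 L)))

omit [NeZero L] in
/-- Triangle inequality for `eucNorm` over a finite sum. -/
theorem eucNorm_sum_le {α : Type*} (s : Finset α) (f : α → Fock (Orb (FermionTorus 2 L))) :
    eucNorm (∑ i ∈ s, f i) ≤ ∑ i ∈ s, eucNorm (f i) := by
  classical
  refine Finset.induction_on s ?_ ?_
  · rw [Finset.sum_empty, Finset.sum_empty, eucNorm_zero]
  · intro a s ha ih
    rw [Finset.sum_insert ha, Finset.sum_insert ha]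
    exact (eucNorm_add_le _ _).trans (add_le_add le_rfl ih)

/-- `‖b_k ψ‖ ≤ ‖ψ‖` (`b_k† b_k = n_{k↑} n_{-k↓} ≤ 1`). [folklore] -/
theorem eucNorm_pairMode_mulVec_le (k : TorusSite 2 L) : eucNorm (pairMode k *ᵥ ψ) ≤ eucNorm ψ := by
  have h := reExp_pairOcc_le ψ k
  rw [pairOcc, reExp, reExp, Matrix.one_mulVec, ← Matrix.mulVec_mulVec, ← star_mulVec_dotProduct_torusOp,
    ← eucNorm_sq, ← eucNorm_sq] at h
  nlinarith [eucNorm_nonneg (pairMode k *ᵥ ψ), eucNorm_nonneg ψ, h]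

/-- Norm form of the block bound with the rounder constant `m/2 + 1 ≥ √(m²/4 + m)`:
`‖b_P ψ‖ ≤ (|P|/2 + 1) ‖ψ‖`. [folklore] -/
theorem eucNorm_blockPair_mulVec_le (P : Finset (TorusSite 2 L)) :
    eucNorm ((∑ k ∈ P, pairMode k) *ᵥ ψ) ≤ ((P.card : ℝ) / 2 + 1) * eucNorm ψ := by
  have h := normSq_blockPair_mulVec_le ψ P
  rw [← eucNorm_sq, ← eucNorm_sq] at h
  have hm : (0 : ℝ) ≤ P.card := Nat.cast_nonneg _
  have hK : (P.card : ℝ) ^ 2 / 4 + P.card ≤ ((P.card : ℝ) / 2 + 1) ^ 2 := by nlinarith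
  have h2 : eucNorm ((∑ k ∈ P, pairMode k) *ᵥ ψ) ^ 2 ≤ (((P.card : ℝ) / 2 + 1) * eucNorm ψ) ^ 2 := by
    rw [mul_pow]
    exact h.trans (mul_le_mul_of_nonneg_right hK (sq_nonneg _))
  have hc : 0 ≤ ((P.card : ℝ) / 2 + 1) * eucNorm ψ := mul_nonneg (by linarith) (eucNorm_nonneg _)
  nlinarith [eucNorm_nonneg ((∑ k ∈ P, pairMode k) *ᵥ ψ), hc, h2]

/-- **Weighted block (one bin).** If the real weights `φ_k`, `k ∈ P`, are within `ε` of a common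
value `v`, then `‖Σ_{k∈P} φ_k b_k ψ‖ ≤ (|v| (|P|/2 + 1) + ε |P|) ‖ψ‖`. [folklore] -/
theorem eucNorm_weightedBlock_mulVec_le (P : Finset (TorusSite 2 L)) (φ : TorusSite 2 L → ℝ)
    (v ε : ℝ) (hε : ∀ k ∈ P, |φ k - v| ≤ ε) :
    eucNorm ((∑ k ∈ P, (φ k : ℂ) • pairMode k) *ᵥ ψ) ≤
      (|v| * ((P.card : ℝ) / 2 + 1) + ε * P.card) * eucNorm ψ := by
  have hsplit : (∑ k ∈ P, (φ k : ℂ) • pairMode k) =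
      (v : ℂ) • (∑ k ∈ P, pairMode k) + ∑ k ∈ P, ((φ k - v : ℝ) : ℂ) • pairMode k := by
    rw [Finset.smul_sum, ← Finset.sum_add_distrib]
    refine Finset.sum_congr rfl fun k _ => ?_
    rw [← add_smul]
    congr 1
    push_cast
    ring
  have hsum : (∑ k ∈ P, ((φ k - v : ℝ) : ℂ) • pairMode k) *ᵥ ψ =
      ∑ k ∈ P, (((φ k - v : ℝ) : ℂ) • pairMode k) *ᵥ ψ := Matrix.sum_mulVec _ _ _
  rw [hsplit, Matrix.add_mulVec, Matrix.smul_mulVec, hsum]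
  refine (eucNorm_add_le _ _).trans ?_
  rw [eucNorm_smul, add_mul]
  refine add_le_add ?_ ?_
  · have hb := eucNorm_blockPair_mulVec_le ψ P
    rw [Complex.norm_real, Real.norm_eq_abs, mul_assoc]
    exact mul_le_mul_of_nonneg_left hb (abs_nonneg v)
  · refine (eucNorm_sum_le _ _).trans ?_
    have hk : ∀ k ∈ P, eucNorm ((((φ k - v : ℝ) : ℂ) • pairMode k) *ᵥ ψ) ≤ ε * eucNorm ψ := by
      intro k hk
      rw [Matrix.smul_mulVec, eucNorm_smul, Complex.norm_real, Real.norm_eq_abs]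
      exact mul_le_mul (hε k hk) (eucNorm_pairMode_mulVec_le ψ k) (eucNorm_nonneg _)
        ((abs_nonneg _).trans (hε k hk))
    refine (Finset.sum_le_sum hk).trans (le_of_eq ?_)
    rw [Finset.sum_const, nsmul_eq_mul]
    ring

/-- **Binned bound for a pair operator.** For any assignment of the momenta of `S` to finitely
many bins `j ∈ J` with representative weights `v_j`, `|φ_k - v_{bin k}| ≤ ε`,
`‖B(φ,S) ψ‖ ≤ (Σ_j |v_j| (|S_j|/2 + 1) + ε |S|) ‖ψ‖`, `S_j = {k ∈ S : bin k = j}`. [folklore] -/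
theorem eucNorm_pairOperator_mulVec_le_of_bins {β : Type*} [DecidableEq β]
    (S : Finset (TorusSite 2 L)) (φ : TorusSite 2 L → ℝ) (J : Finset β) (bin : TorusSite 2 L → β)
    (hJ : ∀ k ∈ S, bin k ∈ J) (v : β → ℝ) (ε : ℝ) (hε : ∀ k ∈ S, |φ k - v (bin k)| ≤ ε) :
    eucNorm (pairOperator φ S *ᵥ ψ) ≤
      (∑ j ∈ J, |v j| * (((S.filter fun k => bin k = j).card : ℝ) / 2 + 1) + ε * S.card) *
        eucNorm ψ := by
  rw [pairOperator, ← Finset.sum_fiberwise_of_maps_to hJ, Matrix.sum_mulVec]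
  refine (eucNorm_sum_le _ _).trans ?_
  have hbin : ∀ j ∈ J,
      eucNorm ((∑ k ∈ S.filter (fun k => bin k = j), (φ k : ℂ) • pairMode k) *ᵥ ψ) ≤
        (|v j| * (((S.filter fun k => bin k = j).card : ℝ) / 2 + 1) +
          ε * (S.filter fun k => bin k = j).card) * eucNorm ψ := by
    intro j _
    refine eucNorm_weightedBlock_mulVec_le ψ _ φ (v j) ε fun k hk => ?_
    rw [Finset.mem_filter] at hk
    rw [← hk.2]
    exact hε k hk.1
  refine (Finset.sum_le_sum hbin).trans (le_of_eq ?_)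
  rw [← Finset.sum_mul, Finset.sum_add_distrib, ← Finset.mul_sum]
  congr 2
  rw [Finset.card_eq_sum_card_fiberwise hJ]
  push_cast
  rfl

/-- `Re⟨ψ, A†A ψ⟩ = ‖Aψ‖²` (local copy). [folklore] -/
private theorem re_expect_conjTranspose_mul_self (A : TorusOp L) :
    (star ψ ⬝ᵥ ((Aᴴ * A) *ᵥ ψ)).re = eucNorm (A *ᵥ ψ) ^ 2 := by
  rw [← Matrix.mulVec_mulVec, ← star_mulVec_dotProduct_torusOp, eucNorm_sq]

/-- **Binned kinematic ceiling for the `d`-wave pair field** (finite volume, every state):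
for any binning of the Brillouin zone as above (`φ = ĝ_d = cos k₁ - cos k₂`, `S = univ`),
`Re⟨ψ, Δ_d† Δ_d ψ⟩ ≤ 8 (Σ_j |v_j| (|S_j|/2 + 1) + ε L²)² ‖ψ‖²`
(`Δ_d†Δ_d = 8 B(ĝ_d)†B(ĝ_d)`, `conjTranspose_pairField_dWave_mul_self`). With bins of width
`ε → 0` and `Σ_k |ĝ_d(k)| / L² → 8/π²` this gives `limsup_L L⁻⁴ sup_ψ ⟨Δ_d†Δ_d⟩ ≤ 128/π⁴`
(R4-MEMO §9.10; the Riemann-sum limit is not formalised here). [folklore] -/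
theorem re_expect_pairField_dWave_sq_le_of_bins {β : Type*} [DecidableEq β] (J : Finset β)
    (bin : TorusSite 2 L → β) (hJ : ∀ k, bin k ∈ J) (v : β → ℝ) (ε : ℝ)
    (hε : ∀ k, |dWaveGap k - v (bin k)| ≤ ε) :
    (star ψ ⬝ᵥ (((pairField dWaveFormFactor L)ᴴ * pairField dWaveFormFactor L) *ᵥ ψ)).re ≤
      8 * (∑ j ∈ J, |v j| *
              ((((Finset.univ : Finset (TorusSite 2 L)).filter fun k => bin k = j).card : ℝ) / 2 + 1) +
            ε * Fintype.card (TorusSite 2 L)) ^ 2 * eucNorm ψ ^ 2 := by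
  rw [conjTranspose_pairField_dWave_mul_self, Matrix.smul_mulVec, dotProduct_smul, smul_eq_mul,
    Complex.re_ofReal_mul, re_expect_conjTranspose_mul_self, mul_assoc]
  refine mul_le_mul_of_nonneg_left ?_ (by norm_num)
  have h := eucNorm_pairOperator_mulVec_le_of_bins ψ Finset.univ dWaveGap J bin (fun k _ => hJ k) v ε
    (fun k _ => hε k)
  rw [Finset.card_univ] at h
  have h0 : 0 ≤ eucNorm (pairOperator dWaveGap Finset.univ *ᵥ ψ) := eucNorm_nonneg _
  rw [← mul_pow]
  exact pow_le_pow_left₀ h0 h 2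

/-- **Uniform bins of width `ε`.** For real weights with `|φ_k| ≤ Φmax` on `S` and any `ε > 0`,
`‖B(φ,S) ψ‖ ≤ (½ Σ_{k∈S} |φ_k| + (3/2) ε |S| + (2Φmax/ε + 1)(Φmax + ε)) ‖ψ‖`
(bins `j = ⌊(φ_k + Φmax)/ε⌋₊`, representatives `v_j = jε - Φmax`; at most `2Φmax/ε + 1` bins).
[folklore] -/
theorem eucNorm_pairOperator_mulVec_le_floorBins (S : Finset (TorusSite 2 L))
    (φ : TorusSite 2 L → ℝ) (Φmax ε : ℝ) (hΦ : 0 ≤ Φmax) (hε : 0 < ε)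
    (hmax : ∀ k ∈ S, |φ k| ≤ Φmax) :
    eucNorm (pairOperator φ S *ᵥ ψ) ≤
      ((∑ k ∈ S, |φ k|) / 2 + 3 / 2 * ε * S.card + (2 * Φmax / ε + 1) * (Φmax + ε)) *
        eucNorm ψ := by
  classical
  set bin : TorusSite 2 L → ℕ := fun k => ⌊(φ k + Φmax) / ε⌋₊ with hbin
  set v : ℕ → ℝ := fun j => (j : ℝ) * ε - Φmax with hv
  set J : Finset ℕ := S.image bin with hJdef
  have hJ : ∀ k ∈ S, bin k ∈ J := fun k hk => Finset.mem_image_of_mem _ hk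
  -- the representative of `k`'s bin is within `ε` below `φ k`
  have hrep : ∀ k ∈ S, 0 ≤ φ k - v (bin k) ∧ φ k - v (bin k) < ε := by
    intro k hk
    have h0 : 0 ≤ (φ k + Φmax) / ε := div_nonneg (by linarith [(abs_le.1 (hmax k hk)).1]) hε.le
    have h1 : ((bin k : ℕ) : ℝ) * ε ≤ φ k + Φmax := (le_div_iff₀ hε).1 (Nat.floor_le h0)
    have h2 : φ k + Φmax < ((bin k : ℕ) : ℝ) * ε + ε := by
      have := Nat.lt_floor_add_one ((φ k + Φmax) / ε)
      rw [div_lt_iff₀ hε] at this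
      linarith
    refine ⟨?_, ?_⟩ <;> simp only [hv] <;> linarith
  have hεk : ∀ k ∈ S, |φ k - v (bin k)| ≤ ε := by
    intro k hk
    rw [abs_le]
    constructor <;> linarith [(hrep k hk).1, (hrep k hk).2]
  have h0 := eucNorm_pairOperator_mulVec_le_of_bins ψ S φ J bin hJ v ε hεk
  refine h0.trans (mul_le_mul_of_nonneg_right ?_ (eucNorm_nonneg ψ))
  -- |v (bin k)| ≤ |φ k| + ε on S
  have hvk : ∀ k ∈ S, |v (bin k)| ≤ |φ k| + ε := by
    intro k hk
    have : v (bin k) = φ k - (φ k - v (bin k)) := by ring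
    rw [this]
    exact (abs_sub _ _).trans (by linarith [hεk k hk])
  -- (i) the `|v_j| · |S_j|` part is `Σ_{k∈S} |v_{bin k}| ≤ Σ |φ_k| + ε|S|`
  have hI : ∑ j ∈ J, |v j| * ((S.filter fun k => bin k = j).card : ℝ) ≤
      ∑ k ∈ S, |φ k| + ε * S.card := by
    have e1 : ∀ j ∈ J, |v j| * ((S.filter fun k => bin k = j).card : ℝ) =
        ∑ k ∈ S.filter (fun k => bin k = j), |v (bin k)| := by
      intro j _
      rw [Finset.sum_congr rfl (g := fun _ => |v j|)
        (fun k hk => by rw [(Finset.mem_filter.1 hk).2]), Finset.sum_const, nsmul_eq_mul, mul_comm]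
    rw [Finset.sum_congr rfl e1, Finset.sum_fiberwise_of_maps_to hJ]
    refine (Finset.sum_le_sum hvk).trans (le_of_eq ?_)
    rw [Finset.sum_add_distrib, Finset.sum_const, nsmul_eq_mul, mul_comm]
  -- (ii) the `Σ_j |v_j|` part: at most `2Φmax/ε + 1` bins, each `|v_j| ≤ Φmax + ε`
  have hII : ∑ j ∈ J, |v j| ≤ (2 * Φmax / ε + 1) * (Φmax + ε) := by
    have hb : ∀ j ∈ J, |v j| ≤ Φmax + ε := by
      intro j hj
      obtain ⟨k, hk, rfl⟩ := Finset.mem_image.1 hj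
      exact (hvk k hk).trans (by linarith [hmax k hk])
    have hcard : (J.card : ℝ) ≤ 2 * Φmax / ε + 1 := by
      have hsub : J ⊆ Finset.range (⌊2 * Φmax / ε⌋₊ + 1) := by
        intro j hj
        obtain ⟨k, hk, rfl⟩ := Finset.mem_image.1 hj
        rw [Finset.mem_range, Nat.lt_succ_iff]
        refine Nat.le_floor ?_
        have h1 : ((bin k : ℕ) : ℝ) * ε ≤ φ k + Φmax := by
          have h0 : 0 ≤ (φ k + Φmax) / ε :=
            div_nonneg (by linarith [(abs_le.1 (hmax k hk)).1]) hε.le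
          exact (le_div_iff₀ hε).1 (Nat.floor_le h0)
        rw [le_div_iff₀ hε]
        linarith [(abs_le.1 (hmax k hk)).2]
      have h1 := Finset.card_le_card hsub
      rw [Finset.card_range] at h1
      have h2 : (J.card : ℝ) ≤ (⌊2 * Φmax / ε⌋₊ : ℝ) + 1 := by exact_mod_cast h1
      exact h2.trans (by linarith [Nat.floor_le (show 0 ≤ 2 * Φmax / ε by positivity)])
    calc ∑ j ∈ J, |v j| ≤ J.card • (Φmax + ε) := Finset.sum_le_card_nsmul _ _ _ hb
      _ = (J.card : ℝ) * (Φmax + ε) := nsmul_eq_mul _ _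
      _ ≤ (2 * Φmax / ε + 1) * (Φmax + ε) :=
          mul_le_mul_of_nonneg_right hcard (by linarith)
  -- combine
  have hsplit : ∑ j ∈ J, |v j| * (((S.filter fun k => bin k = j).card : ℝ) / 2 + 1) =
      (∑ j ∈ J, |v j| * ((S.filter fun k => bin k = j).card : ℝ)) / 2 + ∑ j ∈ J, |v j| := by
    rw [Finset.sum_div, ← Finset.sum_add_distrib]
    exact Finset.sum_congr rfl fun j _ => by ring
  rw [hsplit]
  linarith

omit [NeZero L] in
/-- `|ĝ_d(k)| ≤ 2` (local copy of `abs_dWaveGap_le_two`). [folklore] -/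
private theorem abs_dWaveGap_le_two' (k : TorusSite 2 L) : |dWaveGap k| ≤ 2 := by
  rw [dWaveGap]
  have h1 := Real.abs_cos_le_one (latticeMomentum L k 0)
  have h2 := Real.abs_cos_le_one (latticeMomentum L k 1)
  exact (abs_sub _ _).trans (by linarith)

/-- `#(ℤ/Lℤ)² = L²` as a real number. -/
private theorem card_torusSite_two : (Fintype.card (TorusSite 2 L) : ℝ) = (L : ℝ) ^ 2 := by
  rw [show Fintype.card (TorusSite 2 L) = L ^ 2 by rw [Fintype.card_fun, ZMod.card, Fintype.card_fin]]
  push_cast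
  ring

/-- **Kinematic ceiling for the `d`-wave pair field, explicit finite-volume form.** For every
`L`, every state `ψ` and every bin width `ε > 0`,
`Re⟨ψ, Δ_d†Δ_d ψ⟩ ≤ 8 (Φ_L/2 + (3/2) ε L² + (4/ε + 1)(2 + ε))² ‖ψ‖²`,
`Φ_L = Σ_{k ∈ (ℤ/Lℤ)²} |cos k₁ - cos k₂|`. Since `Φ_L/L² → (2π)⁻² ∫∫|cos x - cos y| = 8/π²`
(exactly `Φ_L = 2cot²(π/2L) ≤ 8L²/π²` for odd `L`), the choice `ε = L^{-1}` gives
`limsup_L L⁻⁴ sup_ψ Re⟨ψ, Δ_d†Δ_d ψ⟩ ≤ 8 · (4/π²)² = 128/π⁴ ≈ 1.314` (R4-MEMO §9.10, rung 0′;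
the scalar limit is not formalised here). HONEST FRAMING: a kinematic (all-states) number for the
ladder; no claim on H/H₀. [folklore] -/
theorem re_expect_pairField_dWave_sq_le (ε : ℝ) (hε : 0 < ε) :
    (star ψ ⬝ᵥ (((pairField dWaveFormFactor L)ᴴ * pairField dWaveFormFactor L) *ᵥ ψ)).re ≤
      8 * ((∑ k : TorusSite 2 L, |dWaveGap k|) / 2 + 3 / 2 * ε * (L : ℝ) ^ 2 +
            (4 / ε + 1) * (2 + ε)) ^ 2 * eucNorm ψ ^ 2 := by
  rw [conjTranspose_pairField_dWave_mul_self, Matrix.smul_mulVec, dotProduct_smul, smul_eq_mul,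
    Complex.re_ofReal_mul, re_expect_conjTranspose_mul_self, mul_assoc]
  refine mul_le_mul_of_nonneg_left ?_ (by norm_num)
  have h := eucNorm_pairOperator_mulVec_le_floorBins ψ Finset.univ dWaveGap 2 ε (by norm_num) hε
    (fun k _ => abs_dWaveGap_le_two' k)
  rw [Finset.card_univ, card_torusSite_two] at h
  have e : (2 * (2 : ℝ) / ε + 1) = 4 / ε + 1 := by ring
  rw [e] at h
  have h0 : 0 ≤ eucNorm (pairOperator dWaveGap Finset.univ *ᵥ ψ) := eucNorm_nonneg _
  rw [← mul_pow]
  exact pow_le_pow_left₀ h0 h 2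

end weighted

end Summit.HubbardSuperconductivity.HubbardLadder
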